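import Summits.QuantumFields.BalabanUV.Beta.D1BFx.SliceTransferDefectJets

/-!
# `BalabanUV.Beta.D1BFx.SliceTransferDefectWard` — road «BF-x» for binder row D1, slot (K), row **(K8-L) «NON-LOCAL REDUCTION»**, PART 2c:
# UNDER «WARD-L» THE DEFLATED JETS ARE THE FORM'S OWN JETS — the Ward letters of `K•` make the deflated jets of `Y = K + B` ADDITIVE
# (`K• +` deflated jets of `B•`), and the deflated jets of a rank-`|ρ|` (co-frame) weight VANISH; hence `(K + defect)• = K•` and PART 2b's
# identity IS K-TA4G's

HONEST DEPENDENCY (cell records, verbatim): «continuum YM on T⁴ ⇐ BetaPertH ∧ nine spine estimates (0/9 proved); BetaPertH ⇐ (D1) ∧ (D4) ∧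
CAP+tail; G-an2-4 gates asym, D1 and NE2/3/4.»  HONEST FRAMING (cell contract, verbatim): «discharging `BetaPertH` makes Bałaban's UV stability
UNCONDITIONAL — a real constructive-QFT result; it is NOT the continuum limit and NOT the Clay problem.»  THIS MODULE DISCHARGES NOTHING of (K),
of D1 or of the wall: [folklore] finite-dimensional jet algebra over PART 2a (`SliceTransferDefectJets`, p249017) and the owner's PART 1
(`SliceTransferDefect`, p248562) BY NAME.  No definition, no `def … : Prop`, nothing cited, no wall binder instantiated, 0 sorry.  It does NOT
decide whether Bałaban's typed literal satisfies «WARD-L» (F-g8-2 §2: the row's letter owners'); it records what follows IF it does.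
NOT D1, NOT BetaPertH, NOT continuum, NOT Clay.

ABSOLUTE RULE (cell charter, verbatim): «No internally-minted statement may enter as a cited fact. Every hypothesis is either kernel-proved in this
package or a verbatim quotation of a PUBLISHED theorem with page reference. The manuscript(s) under audit are NOT citable for their own disputed
steps — they are the thing under adjudication; programme-internal (2001/route/tribunal) claims are never citable.»

WHY (owner F-g8-2 §0 items 3–4 ∕ ruling ρ-g8-3 (4), cut «(ii)»: «the END corollary — if all `E• = 0` (WARD-L) then `D• = 0` and the statement IS
`hessT_gramTransfer_jets`»).  PART 2b proved the second variation with defect for ANY symmetric `Y•`; this file identifies its M-slot with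
K-TA4G's when the form's jets obey the Ward letters and the weight is a co-frame (rank-`|ρ|`) family, JET BY JET:
(i) the Gram ∕ co-frame jets of a form `K` are explicit functionals of its WARD FAILURES `E₀ = K₀W₀`, `Eₛ = KₛW₀ + K₀Wₛ`,
`Eₛₜ = KₛₜW₀ + KₛWₜ + KₜWₛ + K₀Wₛₜ` (§1, pure algebra); (ii) hence under the letters the deflated jets of `K + B` are `K• +` (deflated jets of
`B•`) (§2); (iii) the deflated jets of a co-frame weight `B• = gram•(T•, A•)` vanish identically (§3: the jet form of PART 1's `defect_eq_zero`;
expansion + contraction of `(T₀W₀)(T₀W₀)⁻¹ = 1`, `A₀A₀⁻¹ = 1`; 16 resp. 228 raw monomials, reproduced by the seat's free-algebra normaliser);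
(iv) together: `deflJet• (K + gram•(T,A)) W = K•` (§4).  The closed first jet with NON-zero Ward failure is PART 2d.
CONTENT:
* §0 [folklore] co-frame algebra over a field: `rank_of_coframe` (`B = TᵀAT`, `TW`, `A` units ⇒ `B·W·(WᵀBW)⁻¹·Wᵀ·B = B`), `proj_of_coframe`
  (`B·W·(WᵀBW)⁻¹ = Tᵀ·((TW)⁻¹)ᵀ`: the weight `A` drops out of F-g8-2's projector `𝒫₀`), `coproj_of_coframe`.
* §1 [folklore] `coT₁_eq_ward`, `coTMix_eq_ward`, `gram₁_eq_ward`, `gramMix_eq_ward` (co-frame ∕ Gram jets of `K` through `E•`), additivity in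
  the weight `coT₁_add_weight`, `coTMix_add_weight`, `gram₀∕gram₁∕gramMix_add_weight`.
* §2 [folklore] `deflJet₀∕₁∕Mix_add_of_ward`: under the order ≤ 2 Ward letters (both sides) `deflJet• (K + B) W = K• + deflJet• B W`.
* §3 [folklore] `deflJet₀∕₁∕Mix_coframe`: `deflJet• (gram• T A) W = 0` (symmetric `A•`, `T₀W₀`, `A₀` invertible).
* §4 [folklore] **`deflJet₀∕₁∕Mix_eq_of_wardL`**: letters + co-frame weight ⇒ the deflated jets of `K + gram•(T,A)` ARE `K₀`, `Kₛ`, `Kₛₜ`.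
Provenance: D1 formalisation swarm leaf seat `b2b-balaban-beta-d1-formalise-leaf-04` gen 8 (claim «D1-BFx-K8L» PART 2, cut (ii) by the road
owner `b2b-balaban-beta-d1-p2` gen 8), 2026-08-21.
-/

noncomputable section

namespace Summit.QuantumFields.BalabanUV.Beta.D1BFx.SliceTransferDefectWard

open Matrix
open Summit.QuantumFields.BalabanUV.Beta.D1BFx.GramWeightJets (gram₀ gram₁)
open Summit.QuantumFields.BalabanUV.Beta.D1BFx.GramWeightJetsMixed (gramMix)
open Summit.QuantumFields.BalabanUV.Beta.D1BFx.GramWeightDeterminant (gram_coframe)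
open Summit.QuantumFields.BalabanUV.Beta.D1BFx.SliceTransferDefect (gram_add_of_ward)
open Summit.QuantumFields.BalabanUV.Beta.D1BFx.SliceTransferDefectJets

/-! ## §0 Co-frame algebra over a field -/

section Field

variable {𝕜 : Type*} [Field 𝕜]
variable {ν ρ : Type*} [Fintype ν] [Fintype ρ] [DecidableEq ρ]

/-- [folklore] **A CO-FRAME WEIGHT HAS RANK `|ρ|`**: `B = TᵀAT` with `TW` and `A` invertible satisfies `B·W·(WᵀBW)⁻¹·Wᵀ·B = B`
(the hypothesis `hrank` of PART 1's `defect_eq_zero`; the converse direction is `GramWeightDeterminant.coframe_weight`). -/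
theorem rank_of_coframe (T : Matrix ρ ν 𝕜) (A : Matrix ρ ρ 𝕜) (W : Matrix ν ρ 𝕜) (hTW : IsUnit (T * W).det) (hA : IsUnit A.det) :
    (Tᵀ * A * T) * W * (Wᵀ * (Tᵀ * A * T) * W)⁻¹ * Wᵀ * (Tᵀ * A * T) = Tᵀ * A * T := by
  have hJt : IsUnit (T * W)ᵀ.det := by rw [det_transpose]; exact hTW
  have hinv : (Wᵀ * (Tᵀ * A * T) * W)⁻¹ = (T * W)⁻¹ * A⁻¹ * ((T * W)ᵀ)⁻¹ := by
    rw [gram_coframe, Matrix.mul_inv_rev, Matrix.mul_inv_rev, Matrix.mul_assoc]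
  have hWtTt : Wᵀ * Tᵀ = (T * W)ᵀ := by rw [Matrix.transpose_mul]
  rw [hinv]
  calc Tᵀ * A * T * W * ((T * W)⁻¹ * A⁻¹ * ((T * W)ᵀ)⁻¹) * Wᵀ * (Tᵀ * A * T)
      = Tᵀ * A * ((T * W) * (T * W)⁻¹) * A⁻¹ * (((T * W)ᵀ)⁻¹ * (Wᵀ * Tᵀ)) * A * T := by
        simp only [Matrix.mul_assoc]
    _ = Tᵀ * A * T := by
        rw [mul_nonsing_inv _ hTW, Matrix.mul_one, hWtTt, nonsing_inv_mul _ hJt, Matrix.mul_one, Matrix.mul_assoc Tᵀ A A⁻¹,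
          mul_nonsing_inv _ hA, Matrix.mul_one]

/-- [folklore] **THE PROJECTOR OF A CO-FRAME WEIGHT**: `B·W·(WᵀBW)⁻¹ = Tᵀ·((TW)⁻¹)ᵀ` for `B = TᵀAT` — the weight `A` DROPS OUT (F-g8-2 §1:
`𝒫₀ = B₀W₀Φ₀⁻¹ = T₀ᵀ(T₀W₀)⁻ᵀ`). -/
theorem proj_of_coframe (T : Matrix ρ ν 𝕜) (A : Matrix ρ ρ 𝕜) (W : Matrix ν ρ 𝕜) (hTW : IsUnit (T * W).det) (hA : IsUnit A.det) :
    (Tᵀ * A * T) * W * (Wᵀ * (Tᵀ * A * T) * W)⁻¹ = Tᵀ * ((T * W)⁻¹)ᵀ := by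
  have hinv : (Wᵀ * (Tᵀ * A * T) * W)⁻¹ = (T * W)⁻¹ * A⁻¹ * ((T * W)ᵀ)⁻¹ := by
    rw [gram_coframe, Matrix.mul_inv_rev, Matrix.mul_inv_rev, Matrix.mul_assoc]
  rw [hinv, transpose_nonsing_inv]
  calc Tᵀ * A * T * W * ((T * W)⁻¹ * A⁻¹ * ((T * W)ᵀ)⁻¹)
      = Tᵀ * A * ((T * W) * (T * W)⁻¹) * A⁻¹ * ((T * W)ᵀ)⁻¹ := by simp only [Matrix.mul_assoc]
    _ = Tᵀ * ((T * W)ᵀ)⁻¹ := by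
        rw [mul_nonsing_inv _ hTW, Matrix.mul_one, Matrix.mul_assoc Tᵀ A A⁻¹, mul_nonsing_inv _ hA, Matrix.mul_one]

/-- [folklore] THE CO-PROJECTOR: `(WᵀBW)⁻¹·Wᵀ·B = (TW)⁻¹·T` for `B = TᵀAT` (again `A` drops out). -/
theorem coproj_of_coframe (T : Matrix ρ ν 𝕜) (A : Matrix ρ ρ 𝕜) (W : Matrix ν ρ 𝕜) (hTW : IsUnit (T * W).det) (hA : IsUnit A.det) :
    (Wᵀ * (Tᵀ * A * T) * W)⁻¹ * Wᵀ * (Tᵀ * A * T) = (T * W)⁻¹ * T := by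
  have hJt : IsUnit (T * W)ᵀ.det := by rw [det_transpose]; exact hTW
  have hinv : (Wᵀ * (Tᵀ * A * T) * W)⁻¹ = (T * W)⁻¹ * A⁻¹ * ((T * W)ᵀ)⁻¹ := by
    rw [gram_coframe, Matrix.mul_inv_rev, Matrix.mul_inv_rev, Matrix.mul_assoc]
  have hWtTt : Wᵀ * Tᵀ = (T * W)ᵀ := by rw [Matrix.transpose_mul]
  rw [hinv]
  calc (T * W)⁻¹ * A⁻¹ * ((T * W)ᵀ)⁻¹ * Wᵀ * (Tᵀ * A * T)
      = (T * W)⁻¹ * A⁻¹ * (((T * W)ᵀ)⁻¹ * (Wᵀ * Tᵀ)) * A * T := by simp only [Matrix.mul_assoc]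
    _ = (T * W)⁻¹ * T := by
        rw [hWtTt, nonsing_inv_mul _ hJt, Matrix.mul_one, Matrix.mul_assoc (T * W)⁻¹ A⁻¹ A, nonsing_inv_mul _ hA, Matrix.mul_one]

end Field

section Real

variable {ν ρ : Type*} [Fintype ν] [Fintype ρ] [DecidableEq ρ]

/-! ## §1 Co-frame and Gram jets of a form through its Ward failures; additivity in the weight -/

section WardShapes

variable (W₀ Wₛ Wₜ Wₛₜ : Matrix ν ρ ℝ) (K₀ Kₛ Kₜ Kₛₜ B₀ Bₛ Bₜ Bₛₜ : Matrix ν ν ℝ)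

omit [Fintype ρ] [DecidableEq ρ] in
/-- [folklore] The first co-frame jet of `K` is the transpose of the LEFT first Ward failure: `coT₁ W₀ Wₛ K₀ Kₛ = (KₛᵀW₀ + K₀ᵀWₛ)ᵀ`. -/
theorem coT₁_eq_ward : coT₁ W₀ Wₛ K₀ Kₛ = (Kₛᵀ * W₀ + K₀ᵀ * Wₛ)ᵀ := by
  simp only [coT₁, Matrix.transpose_add, Matrix.transpose_mul, Matrix.transpose_transpose]
  abel

omit [Fintype ρ] [DecidableEq ρ] in
/-- [folklore] The mixed co-frame jet of `K` is the transpose of the LEFT mixed Ward failure. -/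
theorem coTMix_eq_ward : coTMix W₀ Wₛ Wₜ Wₛₜ K₀ Kₛ Kₜ Kₛₜ = (Kₛₜᵀ * W₀ + Kₛᵀ * Wₜ + Kₜᵀ * Wₛ + K₀ᵀ * Wₛₜ)ᵀ := by
  simp only [coTMix, Matrix.transpose_add, Matrix.transpose_mul, Matrix.transpose_transpose]
  abel

omit [Fintype ρ] [DecidableEq ρ] in
/-- [folklore] The first Gram jet of `K` through the Ward failures `E₀ = K₀W₀`, `Eₛ = KₛW₀ + K₀Wₛ`: `gram₁ W₀ Wₛ K₀ Kₛ = WₛᵀE₀ + W₀ᵀEₛ`. -/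
theorem gram₁_eq_ward : gram₁ W₀ Wₛ K₀ Kₛ = Wₛᵀ * (K₀ * W₀) + W₀ᵀ * (Kₛ * W₀ + K₀ * Wₛ) := by
  simp only [gram₁, Matrix.add_mul, Matrix.mul_add, Matrix.mul_assoc]
  abel

omit [Fintype ρ] [DecidableEq ρ] in
/-- [folklore] The mixed Gram jet of `K` through the Ward failures: `gramMix W… K… = WₛₜᵀE₀ + WₛᵀEₜ + WₜᵀEₛ + W₀ᵀEₛₜ`. -/
theorem gramMix_eq_ward :
    gramMix W₀ Wₛ Wₜ Wₛₜ K₀ Kₛ Kₜ Kₛₜ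
      = Wₛₜᵀ * (K₀ * W₀) + Wₛᵀ * (Kₜ * W₀ + K₀ * Wₜ) + Wₜᵀ * (Kₛ * W₀ + K₀ * Wₛ)
        + W₀ᵀ * (Kₛₜ * W₀ + Kₛ * Wₜ + Kₜ * Wₛ + K₀ * Wₛₜ) := by
  simp only [gramMix, Matrix.mul_add, Matrix.mul_assoc]
  abel

omit [Fintype ρ] [DecidableEq ρ] in
/-- [folklore] `coT₁` is additive in the weight. -/
theorem coT₁_add_weight : coT₁ W₀ Wₛ (K₀ + B₀) (Kₛ + Bₛ) = coT₁ W₀ Wₛ K₀ Kₛ + coT₁ W₀ Wₛ B₀ Bₛ := by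
  simp only [coT₁, Matrix.mul_add]; abel

omit [Fintype ρ] [DecidableEq ρ] in
/-- [folklore] `coTMix` is additive in the weight. -/
theorem coTMix_add_weight :
    coTMix W₀ Wₛ Wₜ Wₛₜ (K₀ + B₀) (Kₛ + Bₛ) (Kₜ + Bₜ) (Kₛₜ + Bₛₜ)
      = coTMix W₀ Wₛ Wₜ Wₛₜ K₀ Kₛ Kₜ Kₛₜ + coTMix W₀ Wₛ Wₜ Wₛₜ B₀ Bₛ Bₜ Bₛₜ := by
  simp only [coTMix, Matrix.mul_add]; abel

omit [Fintype ρ] [DecidableEq ρ] in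
/-- [folklore] `gram₀` is additive in the weight. -/
theorem gram₀_add_weight : gram₀ W₀ (K₀ + B₀) = gram₀ W₀ K₀ + gram₀ W₀ B₀ := by
  simp only [gram₀, Matrix.mul_add, Matrix.add_mul]

omit [Fintype ρ] [DecidableEq ρ] in
/-- [folklore] `gram₁` is additive in the weight. -/
theorem gram₁_add_weight : gram₁ W₀ Wₛ (K₀ + B₀) (Kₛ + Bₛ) = gram₁ W₀ Wₛ K₀ Kₛ + gram₁ W₀ Wₛ B₀ Bₛ := by
  simp only [gram₁, Matrix.mul_add, Matrix.add_mul]; abel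

omit [Fintype ρ] [DecidableEq ρ] in
/-- [folklore] `gramMix` is additive in the weight. -/
theorem gramMix_add_weight :
    gramMix W₀ Wₛ Wₜ Wₛₜ (K₀ + B₀) (Kₛ + Bₛ) (Kₜ + Bₜ) (Kₛₜ + Bₛₜ)
      = gramMix W₀ Wₛ Wₜ Wₛₜ K₀ Kₛ Kₜ Kₛₜ + gramMix W₀ Wₛ Wₜ Wₛₜ B₀ Bₛ Bₜ Bₛₜ := by
  simp only [gramMix, Matrix.mul_add, Matrix.add_mul]; abel

end WardShapes

/-! ## §2 Under the Ward letters the deflated jets of `K + B` are `K• +` the deflated jets of `B` -/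

section Additivity

variable (K₀ Kₛ Kₜ Kₛₜ B₀ Bₛ Bₜ Bₛₜ : Matrix ν ν ℝ) (W₀ Wₛ Wₜ Wₛₜ : Matrix ν ρ ℝ)

/-- [folklore] ORDER 0: `K₀W₀ = 0`, `K₀ᵀW₀ = 0` ⇒ `deflJet₀ (K₀ + B₀) W₀ = K₀ + deflJet₀ B₀ W₀`. -/
theorem deflJet₀_add_of_ward (a0 : K₀ * W₀ = 0) (a0t : K₀ᵀ * W₀ = 0) : deflJet₀ (K₀ + B₀) W₀ = K₀ + deflJet₀ B₀ W₀ := by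
  have hWK : W₀ᵀ * K₀ = 0 := by simpa [Matrix.transpose_mul] using congrArg Matrix.transpose a0t
  have h1 : W₀ᵀ * (K₀ + B₀) = W₀ᵀ * B₀ := by rw [Matrix.mul_add, hWK, zero_add]
  have h2 : gram₀ W₀ (K₀ + B₀) = gram₀ W₀ B₀ := gram_add_of_ward B₀ W₀ a0
  unfold deflJet₀
  rw [h1, h2]
  abel

/-- [folklore] ORDER 1: the order ≤ 1 letters (both sides) ⇒ `deflJet₁ (K₀+B₀) (Kₛ+Bₛ) W₀ Wₛ = Kₛ + deflJet₁ B₀ Bₛ W₀ Wₛ`. -/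
theorem deflJet₁_add_of_ward (a0 : K₀ * W₀ = 0) (a0t : K₀ᵀ * W₀ = 0) (aₛ : Kₛ * W₀ + K₀ * Wₛ = 0) (aₛt : Kₛᵀ * W₀ + K₀ᵀ * Wₛ = 0) :
    deflJet₁ (K₀ + B₀) (Kₛ + Bₛ) W₀ Wₛ = Kₛ + deflJet₁ B₀ Bₛ W₀ Wₛ := by
  have hWK : W₀ᵀ * K₀ = 0 := by simpa [Matrix.transpose_mul] using congrArg Matrix.transpose a0t
  have h1 : W₀ᵀ * (K₀ + B₀) = W₀ᵀ * B₀ := by rw [Matrix.mul_add, hWK, zero_add]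
  have h2 : gram₀ W₀ (K₀ + B₀) = gram₀ W₀ B₀ := gram_add_of_ward B₀ W₀ a0
  have h3 : coT₁ W₀ Wₛ (K₀ + B₀) (Kₛ + Bₛ) = coT₁ W₀ Wₛ B₀ Bₛ := by
    rw [coT₁_add_weight, coT₁_eq_ward W₀ Wₛ K₀ Kₛ, aₛt, Matrix.transpose_zero, zero_add]
  have h4 : gram₁ W₀ Wₛ (K₀ + B₀) (Kₛ + Bₛ) = gram₁ W₀ Wₛ B₀ Bₛ := by
    rw [gram₁_add_weight, gram₁_eq_ward W₀ Wₛ K₀ Kₛ, a0, aₛ, Matrix.mul_zero, Matrix.mul_zero, add_zero, zero_add]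
  unfold deflJet₁
  rw [h1, h2, h3, h4]
  abel

/-- [folklore] MIXED ORDER 2: the order ≤ 2 letters (both sides, along `s`, `t` and mixed) ⇒
`deflJetMix (K+B)• W• = Kₛₜ + deflJetMix B• W•`. -/
theorem deflJetMix_add_of_ward (a0 : K₀ * W₀ = 0) (a0t : K₀ᵀ * W₀ = 0) (aₛ : Kₛ * W₀ + K₀ * Wₛ = 0)
    (aₛt : Kₛᵀ * W₀ + K₀ᵀ * Wₛ = 0) (aₜ : Kₜ * W₀ + K₀ * Wₜ = 0) (aₜt : Kₜᵀ * W₀ + K₀ᵀ * Wₜ = 0)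
    (aₛₜ : Kₛₜ * W₀ + Kₛ * Wₜ + Kₜ * Wₛ + K₀ * Wₛₜ = 0) (aₛₜt : Kₛₜᵀ * W₀ + Kₛᵀ * Wₜ + Kₜᵀ * Wₛ + K₀ᵀ * Wₛₜ = 0) :
    deflJetMix (K₀ + B₀) (Kₛ + Bₛ) (Kₜ + Bₜ) (Kₛₜ + Bₛₜ) W₀ Wₛ Wₜ Wₛₜ = Kₛₜ + deflJetMix B₀ Bₛ Bₜ Bₛₜ W₀ Wₛ Wₜ Wₛₜ := by
  have hWK : W₀ᵀ * K₀ = 0 := by simpa [Matrix.transpose_mul] using congrArg Matrix.transpose a0t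
  have h1 : W₀ᵀ * (K₀ + B₀) = W₀ᵀ * B₀ := by rw [Matrix.mul_add, hWK, zero_add]
  have h2 : gram₀ W₀ (K₀ + B₀) = gram₀ W₀ B₀ := gram_add_of_ward B₀ W₀ a0
  have h3 : coT₁ W₀ Wₛ (K₀ + B₀) (Kₛ + Bₛ) = coT₁ W₀ Wₛ B₀ Bₛ := by
    rw [coT₁_add_weight, coT₁_eq_ward W₀ Wₛ K₀ Kₛ, aₛt, Matrix.transpose_zero, zero_add]
  have h3' : coT₁ W₀ Wₜ (K₀ + B₀) (Kₜ + Bₜ) = coT₁ W₀ Wₜ B₀ Bₜ := by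
    rw [coT₁_add_weight, coT₁_eq_ward W₀ Wₜ K₀ Kₜ, aₜt, Matrix.transpose_zero, zero_add]
  have h3'' : coTMix W₀ Wₛ Wₜ Wₛₜ (K₀ + B₀) (Kₛ + Bₛ) (Kₜ + Bₜ) (Kₛₜ + Bₛₜ) = coTMix W₀ Wₛ Wₜ Wₛₜ B₀ Bₛ Bₜ Bₛₜ := by
    rw [coTMix_add_weight, coTMix_eq_ward W₀ Wₛ Wₜ Wₛₜ K₀ Kₛ Kₜ Kₛₜ, aₛₜt, Matrix.transpose_zero, zero_add]
  have h4 : gram₁ W₀ Wₛ (K₀ + B₀) (Kₛ + Bₛ) = gram₁ W₀ Wₛ B₀ Bₛ := by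
    rw [gram₁_add_weight, gram₁_eq_ward W₀ Wₛ K₀ Kₛ, a0, aₛ, Matrix.mul_zero, Matrix.mul_zero, add_zero, zero_add]
  have h4' : gram₁ W₀ Wₜ (K₀ + B₀) (Kₜ + Bₜ) = gram₁ W₀ Wₜ B₀ Bₜ := by
    rw [gram₁_add_weight, gram₁_eq_ward W₀ Wₜ K₀ Kₜ, a0, aₜ, Matrix.mul_zero, Matrix.mul_zero, add_zero, zero_add]
  have h4'' : gramMix W₀ Wₛ Wₜ Wₛₜ (K₀ + B₀) (Kₛ + Bₛ) (Kₜ + Bₜ) (Kₛₜ + Bₛₜ) = gramMix W₀ Wₛ Wₜ Wₛₜ B₀ Bₛ Bₜ Bₛₜ := by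
    rw [gramMix_add_weight, gramMix_eq_ward W₀ Wₛ Wₜ Wₛₜ K₀ Kₛ Kₜ Kₛₜ, a0, aₛ, aₜ, aₛₜ]
    simp only [Matrix.mul_zero, add_zero, zero_add]
  unfold deflJetMix
  rw [h1, h2, h3, h3', h3'', h4, h4', h4'']
  abel

end Additivity

/-! ## §3 The deflated jets of a co-frame (rank-`|ρ|`) weight vanish -/

section Coframe

variable (T₀ Tₛ Tₜ Tₛₜ : Matrix ρ ν ℝ) (A₀ Aₛ Aₜ Aₛₜ : Matrix ρ ρ ℝ) (W₀ Wₛ Wₜ Wₛₜ : Matrix ν ρ ℝ)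

/-- [folklore] ORDER 0: `deflJet₀ (gram₀ T₀ A₀) W₀ = 0` (symmetric `A₀`; `T₀W₀`, `A₀` invertible) — PART 1's `defect_eq_zero` at `K = 0`. -/
theorem deflJet₀_coframe (hA₀ : A₀ᵀ = A₀) (hTW : (T₀ * W₀).det ≠ 0) (hA : A₀.det ≠ 0) : deflJet₀ (gram₀ T₀ A₀) W₀ = 0 := by
  have hB : (gram₀ T₀ A₀)ᵀ = gram₀ T₀ A₀ := by
    simp only [gram₀, Matrix.transpose_mul, Matrix.transpose_transpose, hA₀, Matrix.mul_assoc]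
  rw [deflJet₀_eq_deflate _ _ hB, gram₀, rank_of_coframe T₀ A₀ W₀ (isUnit_iff_ne_zero.2 hTW) (isUnit_iff_ne_zero.2 hA), sub_self]

/-- [folklore] **ORDER 1: `deflJet₁ (gram₀ T₀ A₀) (gram₁ T₀ Tₛ A₀ Aₛ) W₀ Wₛ = 0`** — the first deflated jet of a co-frame weight family
vanishes identically (symmetric `A₀`, `Aₛ`; `T₀W₀`, `A₀` invertible).  Expansion (16 raw monomials) + contraction. -/
theorem deflJet₁_coframe (hA₀ : A₀ᵀ = A₀) (hAₛ : Aₛᵀ = Aₛ) (hTW : (T₀ * W₀).det ≠ 0) (hA : A₀.det ≠ 0) :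
    deflJet₁ (gram₀ T₀ A₀) (gram₁ T₀ Tₛ A₀ Aₛ) W₀ Wₛ = 0 := by
  have hTWu : IsUnit (T₀ * W₀).det := isUnit_iff_ne_zero.2 hTW
  have hAu : IsUnit A₀.det := isUnit_iff_ne_zero.2 hA
  have hTWtu : IsUnit (T₀ * W₀)ᵀ.det := by rw [det_transpose]; exact hTWu
  -- the inverse FP Gram of the co-frame weight: `(Wᵀ(TᵀAT)W)⁻¹ = (TW)⁻¹ A⁻¹ ((TW)ᵀ)⁻¹`
  have hP : (gram₀ W₀ (gram₀ T₀ A₀))⁻¹ = (T₀ * W₀)⁻¹ * A₀⁻¹ * ((T₀ * W₀)ᵀ)⁻¹ := by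
    rw [gram₀, gram₀, gram_coframe, Matrix.mul_inv_rev, Matrix.mul_inv_rev, Matrix.mul_assoc]
  simp only [deflJet₁, coT₁, invJet₁]
  rw [hP]
  set J : Matrix ρ ρ ℝ := T₀ * W₀ with hJ
  -- contraction rules
  have r1 : ∀ X : Matrix ρ ν ℝ, T₀ * (W₀ * (J⁻¹ * X)) = X := fun X => by
    rw [← Matrix.mul_assoc, ← Matrix.mul_assoc, ← hJ, mul_nonsing_inv _ hTWu, Matrix.one_mul]
  have r3 : ∀ X : Matrix ρ ν ℝ, (Jᵀ)⁻¹ * (W₀ᵀ * (T₀ᵀ * X)) = X := fun X => by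
    rw [← Matrix.mul_assoc W₀ᵀ, ← Matrix.transpose_mul, ← hJ, ← Matrix.mul_assoc, nonsing_inv_mul _ hTWtu, Matrix.one_mul]
  have r5 : ∀ X : Matrix ρ ν ℝ, A₀ * (A₀⁻¹ * X) = X := fun X => by rw [← Matrix.mul_assoc, mul_nonsing_inv _ hAu, Matrix.one_mul]
  have r6 : ∀ X : Matrix ρ ν ℝ, A₀⁻¹ * (A₀ * X) = X := fun X => by rw [← Matrix.mul_assoc, nonsing_inv_mul _ hAu, Matrix.one_mul]
  simp only [gram₀, gram₁, Matrix.transpose_add, Matrix.transpose_mul, Matrix.transpose_transpose, hA₀, hAₛ, Matrix.mul_add,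
    Matrix.add_mul, Matrix.neg_mul, Matrix.mul_neg, Matrix.mul_assoc, r1, r3, r5, r6]
  abel

/-- [folklore] **MIXED ORDER 2: `deflJetMix (gram• T A) W• = 0`** — the mixed deflated jet of a co-frame weight family vanishes identically
(symmetric `A•`; `T₀W₀`, `A₀` invertible).  Expansion (228 raw monomials) + contraction. -/
theorem deflJetMix_coframe (hA₀ : A₀ᵀ = A₀) (hAₛ : Aₛᵀ = Aₛ) (hAₜ : Aₜᵀ = Aₜ) (hAₛₜ : Aₛₜᵀ = Aₛₜ) (hTW : (T₀ * W₀).det ≠ 0)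
    (hA : A₀.det ≠ 0) :
    deflJetMix (gram₀ T₀ A₀) (gram₁ T₀ Tₛ A₀ Aₛ) (gram₁ T₀ Tₜ A₀ Aₜ) (gramMix T₀ Tₛ Tₜ Tₛₜ A₀ Aₛ Aₜ Aₛₜ) W₀ Wₛ Wₜ Wₛₜ = 0 := by
  have hTWu : IsUnit (T₀ * W₀).det := isUnit_iff_ne_zero.2 hTW
  have hAu : IsUnit A₀.det := isUnit_iff_ne_zero.2 hA
  have hTWtu : IsUnit (T₀ * W₀)ᵀ.det := by rw [det_transpose]; exact hTWu
  have hP : (gram₀ W₀ (gram₀ T₀ A₀))⁻¹ = (T₀ * W₀)⁻¹ * A₀⁻¹ * ((T₀ * W₀)ᵀ)⁻¹ := by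
    rw [gram₀, gram₀, gram_coframe, Matrix.mul_inv_rev, Matrix.mul_inv_rev, Matrix.mul_assoc]
  simp only [deflJetMix, coT₁, coTMix, invJet₁, invJetMix]
  rw [hP]
  set J : Matrix ρ ρ ℝ := T₀ * W₀ with hJ
  have r1 : ∀ X : Matrix ρ ν ℝ, T₀ * (W₀ * (J⁻¹ * X)) = X := fun X => by
    rw [← Matrix.mul_assoc, ← Matrix.mul_assoc, ← hJ, mul_nonsing_inv _ hTWu, Matrix.one_mul]
  have r3 : ∀ X : Matrix ρ ν ℝ, (Jᵀ)⁻¹ * (W₀ᵀ * (T₀ᵀ * X)) = X := fun X => by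
    rw [← Matrix.mul_assoc W₀ᵀ, ← Matrix.transpose_mul, ← hJ, ← Matrix.mul_assoc, nonsing_inv_mul _ hTWtu, Matrix.one_mul]
  have r5 : ∀ X : Matrix ρ ν ℝ, A₀ * (A₀⁻¹ * X) = X := fun X => by rw [← Matrix.mul_assoc, mul_nonsing_inv _ hAu, Matrix.one_mul]
  have r6 : ∀ X : Matrix ρ ν ℝ, A₀⁻¹ * (A₀ * X) = X := fun X => by rw [← Matrix.mul_assoc, nonsing_inv_mul _ hAu, Matrix.one_mul]
  simp only [gram₀, gram₁, gramMix, Matrix.transpose_add, Matrix.transpose_mul, Matrix.transpose_transpose, hA₀, hAₛ, hAₜ, hAₛₜ,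
    Matrix.mul_add, Matrix.add_mul, Matrix.neg_mul, Matrix.mul_neg, Matrix.sub_mul, Matrix.mul_sub, Matrix.mul_assoc,
    r1, r3, r5, r6]
  abel

end Coframe

/-! ## §4 WARD-L ⇒ the deflated jets of `K + B` are the form's jets `K•` -/

section WardL

variable (K₀ Kₛ Kₜ Kₛₜ : Matrix ν ν ℝ) (T₀ Tₛ Tₜ Tₛₜ : Matrix ρ ν ℝ) (A₀ Aₛ Aₜ Aₛₜ : Matrix ρ ρ ℝ) (W₀ Wₛ Wₜ Wₛₜ : Matrix ν ρ ℝ)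

/-- [folklore] **ORDER 0 under WARD-L**: `K₀W₀ = 0` (both sides) and a co-frame weight ⇒ `deflJet₀ (K₀ + gram₀ T₀ A₀) W₀ = K₀`
(i.e. `defect K₀ B₀ W₀ = 0`, PART 1's `defect_eq_zero` in jet currency). -/
theorem deflJet₀_eq_of_wardL (a0 : K₀ * W₀ = 0) (a0t : K₀ᵀ * W₀ = 0) (hA₀ : A₀ᵀ = A₀) (hTW : (T₀ * W₀).det ≠ 0) (hA : A₀.det ≠ 0) :
    deflJet₀ (K₀ + gram₀ T₀ A₀) W₀ = K₀ := by
  rw [deflJet₀_add_of_ward K₀ (gram₀ T₀ A₀) W₀ a0 a0t, deflJet₀_coframe T₀ A₀ W₀ hA₀ hTW hA, add_zero]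

/-- [folklore] **ORDER 1 under WARD-L**: the order ≤ 1 Ward letters of `K•` (both sides) and a co-frame weight family ⇒
`deflJet₁ (K₀ + gram₀ T₀ A₀) (Kₛ + gram₁ T₀ Tₛ A₀ Aₛ) W₀ Wₛ = Kₛ` — the first jet of the defect VANISHES. -/
theorem deflJet₁_eq_of_wardL (a0 : K₀ * W₀ = 0) (a0t : K₀ᵀ * W₀ = 0) (aₛ : Kₛ * W₀ + K₀ * Wₛ = 0) (aₛt : Kₛᵀ * W₀ + K₀ᵀ * Wₛ = 0)
    (hA₀ : A₀ᵀ = A₀) (hAₛ : Aₛᵀ = Aₛ) (hTW : (T₀ * W₀).det ≠ 0) (hA : A₀.det ≠ 0) :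
    deflJet₁ (K₀ + gram₀ T₀ A₀) (Kₛ + gram₁ T₀ Tₛ A₀ Aₛ) W₀ Wₛ = Kₛ := by
  rw [deflJet₁_add_of_ward K₀ Kₛ (gram₀ T₀ A₀) (gram₁ T₀ Tₛ A₀ Aₛ) W₀ Wₛ a0 a0t aₛ aₛt,
    deflJet₁_coframe T₀ Tₛ A₀ Aₛ W₀ Wₛ hA₀ hAₛ hTW hA, add_zero]

/-- [folklore] **MIXED ORDER 2 under WARD-L**: the order ≤ 2 Ward letters of `K•` (both sides; along `s`, `t`, mixed) and a co-frame weight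
family ⇒ `deflJetMix (K + gram•(T,A))• W• = Kₛₜ` — the mixed jet of the defect VANISHES; with `deflJet₀∕₁_eq_of_wardL` PART 2b's
`hessT_deflate_transfer_jets` then reads with `K•` in the M-slot, i.e. it IS K-TA4G `GramWeightJetsMixed.hessT_gramTransfer_jets`. -/
theorem deflJetMix_eq_of_wardL (a0 : K₀ * W₀ = 0) (a0t : K₀ᵀ * W₀ = 0) (aₛ : Kₛ * W₀ + K₀ * Wₛ = 0)
    (aₛt : Kₛᵀ * W₀ + K₀ᵀ * Wₛ = 0) (aₜ : Kₜ * W₀ + K₀ * Wₜ = 0) (aₜt : Kₜᵀ * W₀ + K₀ᵀ * Wₜ = 0)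
    (aₛₜ : Kₛₜ * W₀ + Kₛ * Wₜ + Kₜ * Wₛ + K₀ * Wₛₜ = 0) (aₛₜt : Kₛₜᵀ * W₀ + Kₛᵀ * Wₜ + Kₜᵀ * Wₛ + K₀ᵀ * Wₛₜ = 0)
    (hA₀ : A₀ᵀ = A₀) (hAₛ : Aₛᵀ = Aₛ) (hAₜ : Aₜᵀ = Aₜ) (hAₛₜ : Aₛₜᵀ = Aₛₜ) (hTW : (T₀ * W₀).det ≠ 0) (hA : A₀.det ≠ 0) :
    deflJetMix (K₀ + gram₀ T₀ A₀) (Kₛ + gram₁ T₀ Tₛ A₀ Aₛ) (Kₜ + gram₁ T₀ Tₜ A₀ Aₜ) (Kₛₜ + gramMix T₀ Tₛ Tₜ Tₛₜ A₀ Aₛ Aₜ Aₛₜ)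
        W₀ Wₛ Wₜ Wₛₜ = Kₛₜ := by
  rw [deflJetMix_add_of_ward K₀ Kₛ Kₜ Kₛₜ (gram₀ T₀ A₀) (gram₁ T₀ Tₛ A₀ Aₛ) (gram₁ T₀ Tₜ A₀ Aₜ) (gramMix T₀ Tₛ Tₜ Tₛₜ A₀ Aₛ Aₜ Aₛₜ)
    W₀ Wₛ Wₜ Wₛₜ a0 a0t aₛ aₛt aₜ aₜt aₛₜ aₛₜt, deflJetMix_coframe T₀ Tₛ Tₜ Tₛₜ A₀ Aₛ Aₜ Aₛₜ W₀ Wₛ Wₜ Wₛₜ hA₀ hAₛ hAₜ hAₛₜ hTW hA, add_zero]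

end WardL

end Real

end Summit.QuantumFields.BalabanUV.Beta.D1BFx.SliceTransferDefectWard

end
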